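import Summits.BirchSwinnertonDyer.BirchSwinnertonDyer.Theorems.Rank2ShaSurjWitness
import Summits.BirchSwinnertonDyer.BirchSwinnertonDyer.Theorems.Rank2ObservatoryTamagawaKernelCert
import Summits.BirchSwinnertonDyer.BirchSwinnertonDyer.Theorems.Rank2ObservatoryPadicAtlasKitMin2
import Summits.BirchSwinnertonDyer.BirchSwinnertonDyer.Theorems.Rank2ObservatoryPadicAtlasKitMin3
import HarnessLib

/-!
# BirchSwinnertonDyer — rank-2 `Ш[p^∞]` cell: the TIER KIT (compact census rows, ONE kernel pass per
# tier file, the row theorem `#Ш(E/ℚ)[p^∞] = p^{b_p}` by membership)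

HONEST FRAMING (cell `b2b-bsdr2sha`, run/shared/lean/b2b/bsd-rank2-sha/): per-pair certified
theorems «cited hypotheses ∧ certified computation ⇒ `Ш(E/ℚ)[p^∞]` finite of order `p^k`» for
rank-2 curves at good ordinary primes; NO claim on BSD in rank `≥ 2`, no class-level theorem, every
published input is a NAMED HYPOTHESIS of the tree (nothing is asserted or minted here).

The row kit `Rank2ShaRowKit.lean` proves the row theorem on an observatory ATLAS CELL, where the
`L`-datum `a = ord_p [T²] L_p` is itself a kernel computation from a symbol table of `p^{n+1}` plus
symbols. A census of ~10⁵ cells (PLAN.md §2, grid G1: every rank-2 curve `N < 30 000` × good ordinary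
`5 ≤ p ≤ 47`) cannot ship a symbol table per cell through the gate, so THIS kit takes the two `p`-adic
data of a row EXACTLY as the census records them — `a = ord_p c₂` (L-side, two independent engines,
census key `ord_p_c2`) and `b = ord_p Reg_p` (H-side, two engines, key `ord_p_Reg_p`) — as HYPOTHESES of
the row theorem (`hLp`/`hcoeff`, `hreg`), and keeps in the KERNEL everything that is cheap integer
arithmetic on the curve: the prime (trial division), `p ∤ Δ`, `#Ẽ(𝔽_p) = p + 1 − a_p` (Euler-criterion
count) and `p ∤ a_p` (GOOD ORDINARY, H1), global minimality of the model (finite criterion, bound `B`),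
Skinner–Urban's (ram) prime and the Frobenius witness for `E[p]` irreducible (`SuWitness`, H6 / (irr)),
and the Tamagawa product (`Tam.TamLocal` row certificate + the `TamX`/`TamZ` exact supplements for the
Kodaira types `IV, IV*, I₀*, Iₙ*`: Tate's algorithm outcome at every bad prime, H9; minimality by the
finite criterion `minCheck`, its Kraus-at-`2` form `minCheck₂`, or the full form `minCheck₃`).

* `ShaRow` — the compact row `(label, a₁…a₆, B, p, sq, ap, w, sw, tam, tamX, tamZ, a, b)`; `ShaRow.check`
  (base: H1, minimality, H9), `ShaRow.checkSU` (base ∧ the Skinner–Urban witness: H6 (ram), (irr)) and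
  `ShaRow.checkK` (base ∧ the Serre witness of H5, `Rank2ShaSurjWitness.lean`);
* soundness: `ShaRow.prime_of_check`, `.isElliptic`, `.isGloballyMinimal`, `.isOrdinaryAt_of_check`,
  `.tamagawaProduct_eq`, `.reductionPointCount_eq`, `.ram_of_checkSU`, `.irr_of_checkSU`;
* `ShaRow.su` — frame «su-exact» (named facts `hSU`, `hS`; newform; `hlow`; `hLp`, `hcoeff : ord = R.a`;
  `Dh`, `hreg : ord Reg = R.b`) ⇒ `rank = 2 ∧ Ш[p^∞] finite ∧ Reg_p ≠ 0 ∧ #Ш[p^∞] = p^k`,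
  `k = R.a + 2 − 2·ord_p #Ẽ(𝔽_p) − ord_p ∏c_ℓ − R.b` (the last two computed in the kernel from `R`);
* `ShaRow.kato`, `ShaRow.kato_eq_one` — frame «kato-bound» (`hK`, `hsurj : Surj`); `ShaRow.finite'` — frame
  «finite» (V-FINITE rows, no image hypothesis: Kato 17.4 (1)(2) + PRS, the observatory's `padicRow`);
* `ShaRow.surj_of_checkSU` — (irr) + (ram) ⇒ `ρ̄_{E,p}` onto (kato-bound booking of an su-exact witness, ruling P-3a);
* `ShaRow.check_of_all` / `checkSU_of_all` / `checkK_of_all` — from a tier theorem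
  `rows.all ShaRow.check(SU|K) = true` (ONE `decide` per file) to the test of a member. The SELF-CONTAINED
  per-row forms `su'`, `kato'`, `katoK'`, `finite'` (instances produced from the check, so that a census
  row's declaration is `ShaRow.su' (checkSU_of_all tier_ok hmem)`) are in `Rank2ShaTierRow.lean`.

References: C. Skinner, E. Urban, Invent. Math. 195 (2014), Thm. 3.6.9 [SkinnerUrban2014]; K. Kato,
Astérisque 295 (2004), Thm. 17.4 [Kato2004Asterisque]; J. Balakrishnan, J. S. Müller, W. Stein, Math.
Comp. 85 (2016), Thm. 1.7 [BalakrishnanMullerStein2015]; W. Stein, C. Wuthrich, Math. Comp. 82 (2013),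
Alg. 11.1 [SteinWuthrich2013]; J. H. Silverman, AEC (2009), VII.1 Remark 1.1, VII.5 Prop. 5.1
[SilvermanAEC2009]; B. Mazur, Invent. Math. 44 (1978), Prop. 6.3 (1) [Mazur1978].
-/

set_option autoImplicit false

-- single-conjunct summit: `Summit.BirchSwinnertonDyer.BirchSwinnertonDyer.…` repeats the name by design
set_option linter.dupNamespace false

noncomputable section

open scoped Classical MatrixGroups ModularForm

open CongruenceSubgroup WeierstrassCurve Literature.NumberTheory.EllipticCurves
  Literature.NumberTheory.EllipticCurves.ModularForms
  Literature.NumberTheory.EllipticCurves.Rank1Residual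
  Summit.BirchSwinnertonDyer.BirchSwinnertonDyer.Rank2Observatory

namespace Summit.BirchSwinnertonDyer.BirchSwinnertonDyer.Rank2Sha

/-! ## §1. The compact census row and its kernel test -/

/-- A COMPACT CENSUS ROW `(E, p)` of the cell: the global minimal model `[a₁, a₂, a₃, a₄, a₆]` (census key
`ainvs`), a bound `B` for the finite minimality criterion, the prime `p` with `sq = ⌊√p⌋`, `ap = a_p`,
the Skinner–Urban witness `w` (H6 / (irr)), the Tamagawa row certificate `tam` (H9), and the two ENGINE
DATA `a = ord_p c₂` (`ord_p_c2`) and `b = ord_p Reg_p` (`ord_p_Reg_p`) — recorded in the row and bound by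
the hypotheses `hcoeff`, `hreg` of the row theorem (NOT kernel-checked). [cite: SteinWuthrich2013, Alg. 11.1] -/
structure ShaRow where
  /-- Cremona label -/
  label : String
  /-- `a₁` -/
  a₁ : ℤ
  /-- `a₂` -/
  a₂ : ℤ
  /-- `a₃` -/
  a₃ : ℤ
  /-- `a₄` -/
  a₄ : ℤ
  /-- `a₆` -/
  a₆ : ℤ
  /-- minimality bound: `|Δ| < B¹²`, `q¹² ∤ Δ ∨ q ∤ c₄` for `q < B` -/
  B : ℕ
  /-- the good ordinary prime `p ≥ 5` -/
  p : ℕ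
  /-- `⌊√p⌋` -/
  sq : ℕ
  /-- `a_p` -/
  ap : ℤ
  /-- the Skinner–Urban witness at `p` (frame «su-exact»; dummy zeros otherwise) -/
  w : SuWitness
  /-- the Serre witness of `ρ̄_{E,p}` surjective (frame «kato-bound»; dummy zeros otherwise) -/
  sw : SurjWitness
  /-- the Tamagawa row certificate (one `TamLocal` per bad prime) -/
  tam : List Tam.TamLocal
  /-- exact supplements at primes of type `IV` / `IV*` (`TamX`) -/
  tamX : List Tam.TamX
  /-- exact supplements at primes of type `I₀*` / `Iₙ*` (`TamZ`) -/
  tamZ : List Tam.TamZ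
  /-- engine datum `ord_p c₂ = ord_p [T²] L_p` (hypothesis `hcoeff`) -/
  a : ℤ
  /-- engine datum `ord_p Reg_p` of THE canonical height, SW13 (4.1) normalisation (hypothesis `hreg`) -/
  b : ℤ

namespace ShaRow

variable (R : ShaRow)

/-- The integer model of the row. [folklore] -/
def e : WeierstrassCurve ℤ := ⟨R.a₁, R.a₂, R.a₃, R.a₄, R.a₆⟩

/-- The row as a cell-less atlas curve (to reuse the atlas kit's minimality criterion). [folklore] -/
def toAtlas : AtlasCurve := ⟨⟨R.label, R.a₁, R.a₂, R.a₃, R.a₄, R.a₆, 0, (0, 0, 0), (0, 0, 0)⟩, R.B, []⟩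

/-- The census exponent of the row: `k = a + 2 − 2·ord_p #Ẽ(𝔽_p) − ord_p ∏c_ℓ − b` (Stein–Wuthrich's
`b_p`), the two middle terms computed from the row. [cite: SteinWuthrich2013, Alg. 11.1 step 4] -/
def k : ℤ :=
  R.a + 2 - 2 * padicValNat R.p (curveCount R.p R.e) -
    padicValNat R.p (Tam.TamZ.rowValueZ R.tam R.tamX R.tamZ) - R.b

/-- **The BASE kernel test of a compact row** (frames «kato-bound», «finite»): `p` prime (trial
division), `p ≥ 5`, `p ∤ Δ`, `#Ẽ(𝔽_p) = p + 1 − a_p`, `p ∤ a_p`, a minimality criterion (plain, Kraus-at-`2`,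
or the full `minCheck₃`), and an EXACT (kernel-sharpened) Tamagawa row certificate. [folklore] -/
def check : Bool :=
  Tam.TamLocal.primeB R.p R.sq && decide (5 ≤ R.p) && decide (¬ ((R.p : ℤ) ∣ R.e.Δ)) &&
    decide ((curveCount R.p R.e : ℤ) = R.p + 1 - R.ap) && decide (¬ ((R.p : ℤ) ∣ R.ap)) &&
    (R.toAtlas.minCheck || R.toAtlas.minCheck₂ || R.toAtlas.minCheck₃) &&
    Tam.TamZ.rowCheckZ R.tam R.tamX R.tamZ R.e && Tam.TamZ.rowExactZ R.tam R.tamX R.tamZ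

/-- **The kernel test of a row of frame «su-exact»**: the base test AND the Skinner–Urban witness
(`Ram`, `Irr`). [cite: SkinnerUrban2014, Thm. 3.6.9 (p. 45)] -/
def checkSU : Bool := R.check && R.w.check R.e R.p

variable {R}

/-- A row passing the su-exact test passes the base test. [folklore] -/
theorem check_of_checkSU (h : R.checkSU = true) : R.check = true := by
  simp only [checkSU, Bool.and_eq_true] at h; exact h.1

/-- A row passing the su-exact test has a passing Skinner–Urban witness. [folklore] -/
theorem wcheck_of_checkSU (h : R.checkSU = true) : R.w.check R.e R.p = true := by
  simp only [checkSU, Bool.and_eq_true] at h; exact h.2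

/-- **The kernel test of a row of frame «kato-bound»**: the base test AND the Serre witness of
`ρ̄_{E,p}` surjective (H5). [cite: Serre1972, §2.8 Prop. 19] -/
def checkK (R : ShaRow) : Bool := R.check && R.sw.check R.e R.p

/-- A row passing the kato-bound test passes the base test. [folklore] -/
theorem check_of_checkK (h : R.checkK = true) : R.check = true := by
  simp only [checkK, Bool.and_eq_true] at h; exact h.1

/-- A row passing the kato-bound test has a passing Serre witness. [folklore] -/
theorem swcheck_of_checkK (h : R.checkK = true) : R.sw.check R.e R.p = true := by
  simp only [checkK, Bool.and_eq_true] at h; exact h.2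

variable (h : R.check = true)
include h

/-- Unpacking a passing base check. [folklore] -/
theorem check_spec :
    R.p.Prime ∧ 5 ≤ R.p ∧ ¬ ((R.p : ℤ) ∣ R.e.Δ) ∧ (curveCount R.p R.e : ℤ) = R.p + 1 - R.ap ∧
      ¬ ((R.p : ℤ) ∣ R.ap) ∧
      ((R.toAtlas.minCheck = true ∨ R.toAtlas.minCheck₂ = true) ∨ R.toAtlas.minCheck₃ = true) ∧
      Tam.TamZ.rowCheckZ R.tam R.tamX R.tamZ R.e = true ∧
      Tam.TamZ.rowExactZ R.tam R.tamX R.tamZ = true := by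
  simp only [check, Bool.and_eq_true, Bool.or_eq_true, decide_eq_true_eq] at h
  obtain ⟨⟨⟨⟨⟨⟨⟨hP, h5⟩, hΔ⟩, hc⟩, hap⟩, hmin⟩, ht⟩, hx⟩ := h
  exact ⟨Tam.TamLocal.prime_of_primeB hP, h5, hΔ, hc, hap, hmin, ht, hx⟩

/-- A checking row's `p` is prime. [folklore] -/
theorem prime_of_check : R.p.Prime := (check_spec h).1

/-- A checking row's `p` is at least `5`. [folklore] -/
theorem five_le_of_check : 5 ≤ R.p := (check_spec h).2.1

/-- A checking row's curve is elliptic (`Δ ≠ 0`, from `p ∤ Δ`). [folklore] -/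
theorem isElliptic : (R.e.baseChange ℚ).IsElliptic :=
  Literature.NumberTheory.EllipticCurves.isElliptic_baseChange_int _ fun h0 =>
    (check_spec h).2.2.1 (by rw [h0]; exact dvd_zero _)

/-- A checking row's integer model is globally minimal (finite criterion). [cite: SilvermanAEC2009, VII.1 Remark 1.1] -/
theorem isGloballyMinimal : (R.e.baseChange ℚ).IsGloballyMinimal := by
  rcases (check_spec h).2.2.2.2.2.1 with (h1 | h2) | h3
  · exact AtlasCurve.isGloballyMinimal h1
  · exact AtlasCurve.isGloballyMinimal₂ h2
  · exact AtlasCurve.isGloballyMinimal₃ h3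

/-- A checking row's prime is good ORDINARY (H1). [cite: SilvermanAEC2009, VII.1 Remark 1.1] -/
theorem isOrdinaryAt_of_check [Fact R.p.Prime] [(R.e.baseChange ℚ).IsGloballyMinimal] :
    IsOrdinaryAt (R.e.baseChange ℚ) R.p := by
  obtain ⟨-, h5, hΔ, hc, hap, -⟩ := check_spec h
  have hp2 : R.p ≠ 2 := by omega
  refine isOrdinaryAt_baseChange_int_of_card R.p R.e hΔ (card_eq_curveCount R.p hp2 R.e hΔ) ?_
  rw [hc]
  have : (R.p : ℤ) + 1 - (R.p + 1 - R.ap) = R.ap := by ring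
  rw [this]
  exact hap

/-- At a checking row, the tree's `#Ẽ(𝔽_p)` is the kernel count `curveCount p e`. [folklore] -/
theorem reductionPointCount_eq [Fact R.p.Prime] [(R.e.baseChange ℚ).IsGloballyMinimal] :
    (R.e.baseChange ℚ).reductionPointCount R.p = curveCount R.p R.e := by
  obtain ⟨-, h5, hΔ, -⟩ := check_spec h
  rw [reductionPointCount_baseChange_int, card_eq_curveCount R.p (by omega) R.e hΔ]

/-- At a checking row, the Tamagawa product IS the certificate's `rowValueZ` (H9).
[cite: SilvermanATAEC1994, IV.9.4] -/
theorem tamagawaProduct_eq [(R.e.baseChange ℚ).IsGloballyMinimal] :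
    (R.e.baseChange ℚ).tamagawaProduct = Tam.TamZ.rowValueZ R.tam R.tamX R.tamZ :=
  Tam.TamZ.tamagawaProduct_eqZ (check_spec h).2.2.2.2.2.2.1 inferInstance (check_spec h).2.2.2.2.2.2.2

omit h in
/-- At a row passing the su-exact test, `Ram E p` (H6: S–U's (ram)). [cite: SkinnerUrban2014, Thm. 3.6.9 (p. 45)] -/
theorem ram_of_checkSU (h : R.checkSU = true) [Fact R.p.Prime] [(R.e.baseChange ℚ).IsElliptic]
    [(R.e.baseChange ℚ).IsGloballyMinimal] : Ram (R.e.baseChange ℚ) R.p :=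
  SuWitness.ram_of_check (wcheck_of_checkSU h) _ (integralModelInt_baseChange_int R.e)

omit h in
/-- At a row passing the su-exact test, `E[p]` is irreducible. [cite: Mazur1978, §6 Prop. 6.3 (1) (p. 153)] -/
theorem irr_of_checkSU (h : R.checkSU = true) [Fact R.p.Prime] [(R.e.baseChange ℚ).IsElliptic]
    [(R.e.baseChange ℚ).IsGloballyMinimal] : (R.e.baseChange ℚ).HasIrreducibleModPGaloisRep R.p :=
  SuWitness.irr_of_check (wcheck_of_checkSU h) _ (integralModelInt_baseChange_int R.e)

omit h in
/-- At a row passing the su-exact test, `ρ̄_{E,p}` is SURJECTIVE (H5 decided by (irr) + (ram): the tree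
theorem `surj_of_irr_of_ram`, Serre's inertia argument at the (ram) prime). [cite: Serre1972, §5.2 (iii)]
[cite: SkinnerUrban2014, Thm. 3.6.9 (p. 45)] -/
theorem surj_of_checkSU (h : R.checkSU = true) [Fact R.p.Prime] [(R.e.baseChange ℚ).IsElliptic]
    [(R.e.baseChange ℚ).IsGloballyMinimal] : (R.e.baseChange ℚ).HasSurjectiveModNGaloisRep R.p :=
  surj_of_irr_of_ram _ _ (irr_of_checkSU h) (ram_of_checkSU h)

omit h in
/-- From a tier theorem `rows.all check = true` to the base test of a member. [folklore] -/
theorem check_of_all {rows : List ShaRow} (hall : rows.all ShaRow.check = true) {R : ShaRow}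
    (hR : R ∈ rows) : R.check = true := by
  simp only [List.all_eq_true] at hall
  exact hall R hR

omit h in
/-- From a tier theorem `rows.all checkSU = true` to the su-exact test of a member. [folklore] -/
theorem checkSU_of_all {rows : List ShaRow} (hall : rows.all ShaRow.checkSU = true) {R : ShaRow}
    (hR : R ∈ rows) : R.checkSU = true := by
  simp only [List.all_eq_true] at hall
  exact hall R hR

omit h in
/-- At a row passing the kato-bound test, `ρ̄_{E,p}` is surjective (H5, Serre Prop. 19 in the kernel).
[cite: Serre1972, §2.8 Prop. 19 and §5.2 (iii)] -/
theorem surj_of_checkK (h : R.checkK = true) [Fact R.p.Prime] [(R.e.baseChange ℚ).IsElliptic]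
    [(R.e.baseChange ℚ).IsGloballyMinimal] : (R.e.baseChange ℚ).HasSurjectiveModNGaloisRep R.p :=
  SurjWitness.surj_of_check (swcheck_of_checkK h) _ (integralModelInt_baseChange_int R.e)

omit h in
/-- From a tier theorem `rows.all checkK = true` to the kato-bound test of a member. [folklore] -/
theorem checkK_of_all {rows : List ShaRow} (hall : rows.all ShaRow.checkK = true) {R : ShaRow}
    (hR : R ∈ rows) : R.checkK = true := by
  simp only [List.all_eq_true] at hall
  exact hall R hR

/-! ## §2. The row theorems -/

omit h in
/-- **TIER ROW THEOREM, frame «su-exact».** For a checking compact row `R` (kernel: `p ≥ 5` good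
ordinary, minimal model, `Ram`, `Irr`, exact Tamagawa certificate), GIVEN the named facts `hS`
(Perrin-Riou–Schneider, BMS Thm. 1.7) and `hSU` (Skinner–Urban Thm. 3.6.9, every cyclotomic datum), the
newform `hf`, the census rank certificate `hlow : 2 ≤ rank`, the L-side data `hLp : [T²] L_p ≠ 0`,
`hcoeff : ord_p [T²] L_p = R.a` (two engines, SW13 Prop. 3.5 precision), THE canonical height `Dh` with
`hreg : ord_p Reg_p(E, Dh) = R.b` (two engines): `rank_ℤ E(ℚ) = 2`, `Ш(E/ℚ)[p^∞]` finite, `Reg_p ≠ 0`, and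
`#Ш(E/ℚ)[p^∞] = p^k` with `k = R.k = R.a + 2 − 2·ord_p #Ẽ(𝔽_p) − ord_p ∏c_ℓ − R.b`. Per pair; NOT a class
theorem. [cite: SkinnerUrban2014, Thm. 3.6.9 (p. 45)] [cite: BalakrishnanMullerStein2015, Thm. 1.7]
[cite: SteinWuthrich2013, §§3–4 and Alg. 11.1] -/
theorem su (h : R.checkSU = true) [Fact R.p.Prime] [(R.e.baseChange ℚ).IsElliptic]
    [(R.e.baseChange ℚ).IsGloballyMinimal]
    (hS : Schneider1985_order_charGenerator_odd) {N : ℕ} [NeZero N] {f : CuspForm (Gamma0 N) 2}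
    (hf : IsNewformOf (R.e.baseChange ℚ) f)
    (hSU : ∀ (κ : ZpExtension ℚ R.p) (γ : Field.absoluteGaloisGroup ℚ),
      skinner_urban_main_conjecture (R.e.baseChange ℚ) R.p (κ := κ) (γ := γ) (f := f))
    (hlow : 2 ≤ (R.e.baseChange ℚ).mordellWeilRank)
    (hLp : PowerSeries.coeff 2 (padicLFunction f (unitRoot (R.e.baseChange ℚ) R.p : ℚ_[R.p])) ≠ 0)
    (hcoeff : (PowerSeries.coeff 2
      (padicLFunction f (unitRoot (R.e.baseChange ℚ) R.p : ℚ_[R.p]))).valuation = R.a)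
    (Dh : PAdicHeightData (R.e.baseChange ℚ) R.p) (hDh : Dh.IsCanonical)
    (hreg : (padicRegulator Dh).valuation = R.b) :
    (R.e.baseChange ℚ).mordellWeilRank = 2 ∧
      Finite (AddCommGroup.primaryComponent (R.e.baseChange ℚ).sha R.p) ∧ SchneiderConjecture Dh ∧
      ∃ k : ℕ, Nat.card (AddCommGroup.primaryComponent (R.e.baseChange ℚ).sha R.p) = R.p ^ k ∧
        (k : ℤ) = R.k := by
  have hb := check_of_checkSU h
  obtain ⟨hr, hfin, hSch, k, hcard, hkval⟩ := card_shaPrimary_eq_pow_of_certificate hS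
    (R.e.baseChange ℚ) R.p f hSU (five_le_of_check hb) (isOrdinaryAt_of_check hb) (irr_of_checkSU h)
    (ram_of_checkSU h) hf hlow hLp Dh hDh hcoeff hreg
  refine ⟨hr, hfin, hSch, k, hcard, ?_⟩
  rw [hkval, reductionPointCount_eq hb, tamagawaProduct_eq hb, ShaRow.k]
  push_cast
  ring

/-- **TIER ROW THEOREM, frame «kato-bound».** As `ShaRow.su` with Kato's Thm. 17.4 (`hK`) for
Skinner–Urban and the census surjectivity bit `hsurj : Surj E p` (Serre witnesses): `rank = 2`,
`Ш(E/ℚ)[p^∞]` finite, `Reg_p ≠ 0`, `ord_p #Ш(E/ℚ)[p^∞] ≤ R.k`. Per pair; NOT a class theorem.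
[cite: Kato2004Asterisque, Thm. 17.4 (3) (p. 273)] [cite: BalakrishnanMullerStein2015, Thm. 1.7]
[cite: SteinWuthrich2013, Alg. 11.1 and Prop. 11.2] -/
theorem kato [Fact R.p.Prime] [(R.e.baseChange ℚ).IsElliptic] [(R.e.baseChange ℚ).IsGloballyMinimal]
    (hS : Schneider1985_order_charGenerator_odd) {N : ℕ} [NeZero N] {f : CuspForm (Gamma0 N) 2}
    (hf : IsNewformOf (R.e.baseChange ℚ) f)
    (hK : ∀ (κ : ZpExtension ℚ R.p) (γ : Field.absoluteGaloisGroup ℚ),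
      kato_divisibility (R.e.baseChange ℚ) R.p (κ := κ) (γ := γ) (f := f))
    (hsurj : (R.e.baseChange ℚ).HasSurjectiveModNGaloisRep R.p)
    (hlow : 2 ≤ (R.e.baseChange ℚ).mordellWeilRank)
    (hLp : PowerSeries.coeff 2 (padicLFunction f (unitRoot (R.e.baseChange ℚ) R.p : ℚ_[R.p])) ≠ 0)
    (hcoeff : (PowerSeries.coeff 2
      (padicLFunction f (unitRoot (R.e.baseChange ℚ) R.p : ℚ_[R.p]))).valuation = R.a)
    (Dh : PAdicHeightData (R.e.baseChange ℚ) R.p) (hDh : Dh.IsCanonical)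
    (hreg : (padicRegulator Dh).valuation = R.b) :
    (R.e.baseChange ℚ).mordellWeilRank = 2 ∧
      Finite (AddCommGroup.primaryComponent (R.e.baseChange ℚ).sha R.p) ∧ SchneiderConjecture Dh ∧
      (padicValNat R.p (Nat.card (AddCommGroup.primaryComponent (R.e.baseChange ℚ).sha R.p)) : ℤ) ≤
        R.k := by
  obtain ⟨hr, hfin, hSch, hle⟩ := card_shaPrimary_le_of_kato_certificate hS (R.e.baseChange ℚ) R.p f
    hK (five_le_of_check h) (isOrdinaryAt_of_check h) hsurj hf hlow hLp Dh hDh hcoeff hreg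
  refine ⟨hr, hfin, hSch, ?_⟩
  rw [reductionPointCount_eq h, tamagawaProduct_eq h] at hle
  rw [ShaRow.k]
  push_cast at hle ⊢
  linarith

/-- **Frame «kato-bound», `R.k ≤ 0`: `Ш(E/ℚ)[p^∞] = 0` exactly** (Stein–Wuthrich's verdict «Ш[p] = 0»).
[cite: SteinWuthrich2013, Thm. 1.1 and Alg. 11.1] [cite: Kato2004Asterisque, Thm. 17.4 (3) (p. 273)] -/
theorem kato_eq_one [Fact R.p.Prime] [(R.e.baseChange ℚ).IsElliptic]
    [(R.e.baseChange ℚ).IsGloballyMinimal]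
    (hS : Schneider1985_order_charGenerator_odd) {N : ℕ} [NeZero N] {f : CuspForm (Gamma0 N) 2}
    (hf : IsNewformOf (R.e.baseChange ℚ) f)
    (hK : ∀ (κ : ZpExtension ℚ R.p) (γ : Field.absoluteGaloisGroup ℚ),
      kato_divisibility (R.e.baseChange ℚ) R.p (κ := κ) (γ := γ) (f := f))
    (hsurj : (R.e.baseChange ℚ).HasSurjectiveModNGaloisRep R.p)
    (hlow : 2 ≤ (R.e.baseChange ℚ).mordellWeilRank)
    (hLp : PowerSeries.coeff 2 (padicLFunction f (unitRoot (R.e.baseChange ℚ) R.p : ℚ_[R.p])) ≠ 0)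
    (hcoeff : (PowerSeries.coeff 2
      (padicLFunction f (unitRoot (R.e.baseChange ℚ) R.p : ℚ_[R.p]))).valuation = R.a)
    (Dh : PAdicHeightData (R.e.baseChange ℚ) R.p) (hDh : Dh.IsCanonical)
    (hreg : (padicRegulator Dh).valuation = R.b) (hk0 : R.k ≤ 0) :
    (R.e.baseChange ℚ).mordellWeilRank = 2 ∧
      Finite (AddCommGroup.primaryComponent (R.e.baseChange ℚ).sha R.p) ∧ SchneiderConjecture Dh ∧
      Nat.card (AddCommGroup.primaryComponent (R.e.baseChange ℚ).sha R.p) = 1 := by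
  obtain ⟨hr, hfin, hSch, hle⟩ := kato h hS hf hK hsurj hlow hLp hcoeff Dh hDh hreg
  haveI := hfin
  have hv0 : padicValNat R.p (Nat.card (AddCommGroup.primaryComponent (R.e.baseChange ℚ).sha R.p)) = 0 := by
    have := hle.trans hk0
    omega
  have hndvd : ¬ R.p ∣ Nat.card (AddCommGroup.primaryComponent (R.e.baseChange ℚ).sha R.p) := by
    rcases padicValNat.eq_zero_iff.mp hv0 with h1 | h0 | hnd
    · exact absurd h1 (Fact.out : R.p.Prime).one_lt.ne'
    · exact absurd h0 Nat.card_pos.ne'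
    · exact hnd
  exact ⟨hr, hfin, hSch, natCard_primaryComponent_eq_one R.p hndvd⟩

end ShaRow

end Summit.BirchSwinnertonDyer.BirchSwinnertonDyer.Rank2Sha

end
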